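import Summits.HodgeConjecture.HodgeConjecture.Theorems.MarkmanPartnerTransportK3Sq2KugaSatakeSelfDescentHK
import Summits.HodgeConjecture.HodgeConjecture.Theorems.MarkmanPartnerTransportK3Sq2KugaSatakeSelfTransposeHK
import Literature.AlgebraicGeometry.Motives.HodgeStructureK3RealMultProofs

/-!
# Route MarkmanPartnerTransport · crux `LowPicardRealMultiplication` (stmt-HodgeConjecture-19653) —
# programme «KS-SELF-X», step 4: A RATIONAL HODGE SELF-SIMILITUDE OF `T(X)` IS ALGEBRAIC ON `T(X)` FOR A MARKED
# `K3^{[2]}`-TYPE FOURFOLD, GRANTED KUGA–SATAKE AND CHARLES–MARKMAN — VARESCO'S COR. 4.6 DISCHARGED HERE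

`OrphanKSCore.exists_algebraicCorrespondence_eq_on_bbfTransc_of_kugaSatake` (crux #5, cell (1,2)) deduces, for a
marked smooth projective `K3^{[2]}`-type fourfold `X` and `θ : H²(X(ℂ); ℂ) → H²(X(ℂ); ℂ)` rational, type-preserving,
`q`-self-adjoint with `q`-transcendental image and `θ² = d ≠ 0` on `T(X)`, an algebraic self-correspondence of `X`
equal to `θ` on `T(X)` — from THREE inputs: the Kuga–Satake hypothesis `IsKSCorrespondenceAlgebraicHK 2` (open),
Charles–Markman's `B(X)` (record), and the NAMED FACT `hVar = Varesco2023_transcendentalHodgeSimilitude_algebraic_of_lefschetzStandard`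
(Varesco 2023 Cor. 4.6, unproved in the tree). This file PROVES the same conclusion WITHOUT `hVar`
(`exists_algebraicCorrespondence_eq_on_bbfTransc_of_kugaSatake'`), by running Varesco's §4 argument in the kernel
on the fourfold (programme «KS-SELF-X», files `…K3Sq2KugaSatakeSelf{Presentation,Transpose,Descent}HK` and this
seat's presentation `…K3Sq2TranscendentalPresentationHK`): two presentations `(T, −q_B|_T, ι)` and
`(T, −d·q_B|_T, ι ∘ θ_T)` of `T(X)_ℚ` on ONE Kuga–Satake variety `A`, algebraic `O₁, O₂ : H²(X) → H²(A × A)` with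
`O₂ ∘ θ = O₁` on `T`, the Lefschetz–transpose `R = *_L ∘ ᵗO₁ ∘ L^{g-2}` (back to `H²` through `B(X)`),
`f_i = R ∘ O_i` algebraic with `f₁ σ ≠ 0` (Hodge–Riemann), rational descent `a₂ ∘ θ_T = a₁ ≠ 0` in the FIELD
`End_Hdg(T(X)_ℚ)` (Zarhin), and the subfield trick `θ_T = a₂⁻¹ a₁ ∈ R_s` (cycle-induced).

CONDITIONAL on `IsKSCorrespondenceAlgebraicHK 2` for `X` (the Kuga–Satake Hodge conjecture, OPEN in print for
`K3^{[n]}`-type) and on the Charles–Markman record; no sorry, no new definition or named fact; nothing here says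
HC or the crux is proved. Prover seat hodge-nonav-19652-p1 (gen 15), `--supports stmt-HodgeConjecture-19653`.

References: M. Varesco, Math. Z. 305 (2023) §0.3, Lemma 4.4, Thm. 4.5, Cor. 4.6, Rem. 5.5; F. Charles, E. Markman,
Compos. Math. 149 (2013) Thm. 1.1; Yu. Zarhin, J. reine angew. Math. 341 (1983) Thm. 1.5.1; D. Huybrechts,
Comment. Math. Helv. 94 (2019) Rem. 3.3; B. van Geemen (2000) §10; S. Floccari, arXiv:2210.02948 §5.1.
-/

set_option linter.dupNamespace false

noncomputable section

namespace Summit.HodgeConjecture.HodgeConjecture.Theorems.MarkmanPartnerTransport.KugaSatakeHK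

open scoped TensorProduct
open CategoryTheory MonoidalCategory Literature.AlgebraicGeometry Literature.AlgebraicGeometry.Motives
open Summit.HodgeConjecture.HodgeConjecture.Ring2.AbelianAll
open Literature.AlgebraicGeometry.HodgeTheory Literature.AlgebraicTopology.SingularHomology
open Literature.AlgebraicGeometry.Motives.HodgeStructure Literature.AlgebraicGeometry.Hyperkaehler
open Literature.AlgebraicGeometry.Surfaces
open Summit.HodgeConjecture.HodgeConjecture.Theorems.NikulinTwinTransport
open Summit.HodgeConjecture.HodgeConjecture.Theorems.MarkmanPartnerTransport.BBFPositivity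
open Summit.HodgeConjecture.HodgeConjecture.Theorems.MarkmanPartnerTransport.PartnerLattice
open Summit.HodgeConjecture.HodgeConjecture.Theorems.MarkmanPartnerTransport.KugaSatakeSelf

variable {X : SchemeOver ℂ} {φ : complexBetti X 2 ≃ₗ[ℂ] (K3HilbertIndex → ℂ)} {P : complexBetti X (2 * 4)}
  {z : K3HilbertIndex → ℂ}

/-- `MarkedK3Sq[X, φ, P, z]`: VERBATIM the `let MarkedK3Sq := …` binder of the route declarations of
MarkmanPartnerTransport (clauses (m1)–(m6)). Local notation only. -/
local notation3 (prettyPrint := false) "MarkedK3Sq[" X ", " φ ", " P ", " z "]" =>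
  (((IsIntegralClass P ∧ ∀ Q : complexBetti X (2 * 4), IsIntegralClass Q → ∃ n : ℤ, Q = n • P) ∧
    (∀ c : complexBetti X 2, IsIntegralClass c ↔ ∃ v : K3HilbertIndex → ℤ, φ c = fun i => (v i : ℂ)) ∧
    (∀ a : complexBetti X 2, cupPowTwo a 4 = ((3 : ℂ) * (k3HilbertForm 2 (φ a) (φ a)) ^ 2) • P) ∧
    (IsOfHodgeType 4 X 2 2 0 (LinearEquiv.symm φ z) ∧
      ∀ τ : complexBetti X 2, IsOfHodgeType 4 X 2 2 0 τ → ∃ t : ℂ, τ = t • LinearEquiv.symm φ z) ∧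
    (∀ c : complexBetti X 2, IsOfHodgeType 4 X 2 1 1 c ↔
      (k3HilbertForm 2 (φ c) z = 0 ∧ k3HilbertForm 2 (φ c) (star z) = 0)) ∧
    (k3HilbertForm 2 z z = 0 ∧ 0 < (k3HilbertForm 2 (star z) z).re)))

/-- `H²_B[hX]`: the weight-two `ℚ`-Hodge structure on `H²(X(ℂ); ℚ)` of the real Hodge model of the fourfold
`X` (`hX : IsSmoothProjective (2 * 2) X`). Local notation only. -/
local notation3 "H²_B[" hX "]" =>
  bettiTwoHodgeStructureOfModel hX (BettiUniverse.realHodgeModel exists_isReal_hodgeModel_holds hX)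
    (BettiUniverse.realHodgeModel_isHodgeSymmetric exists_isReal_hodgeModel_holds hX)

/-- `Θ : ℂ ⊗_ℚ H²(X(ℂ); ℚ) → H²(X(ℂ); ℂ)`. -/
local notation3 "Θ[" X "]" => ofRatClassBaseChange (Motives.ComplexPoints X) (2 * 1)

/-- `ι : H²(X(ℂ); ℚ) → H²(X(ℂ); ℂ)`, the rational lattice. -/
local notation3 "ι[" X "]" => ofRatClass (Motives.ComplexPoints X) (2 * 1)


/-! ### §5 The theorem -/

/-- **A RATIONAL HODGE SELF-SIMILITUDE OF `T(X)` IS ALGEBRAIC ON `T(X)`, FOR A MARKED SMOOTH PROJECTIVE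
`K3^{[2]}`-TYPE FOURFOLD — GRANTED KUGA–SATAKE FOR `X` AND CHARLES–MARKMAN, WITHOUT VARESCO'S RECORD.** The
hypotheses are VERBATIM those of `OrphanKSCore.exists_algebraicCorrespondence_eq_on_bbfTransc_of_kugaSatake` with
`hVar` removed (and the projective-irreducible-symplectic witness replaced by the smooth-projective one it
projects to): `θ` rational (`h1`), type-preserving (`h2`), with `q`-transcendental image (`h4`), `q`-self-adjoint
(`h5`), `θ(θ y) = d y` on the `q`-transcendental classes, `d ≠ 0`. Conclusion: an algebraic self-correspondence
`T_alg` of `X` with `T_alg y = θ y` for every `q`-transcendental `y`. Proof: module docstring.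
[cite: Varesco2023, Cor. 4.6, Thm. 4.5 and §0.3] [cite: CharlesMarkman2013, Thm. 1.1 (§1)]
[cite: Zarhin1983HodgeGroupsK3, Thm. 1.5.1] [cite: Floccari2024, §5.1] -/
theorem exists_algebraicCorrespondence_eq_on_bbfTransc_of_kugaSatake'
    (hCM : CharlesMarkman2013_lefschetzStandard_K3HilbertType)
    (hX : IsSmoothProjective (2 * 2) X) (hK : IsOfK3HilbertSquareType X) (hM : MarkedK3Sq[X, φ, P, z])
    (hKS : IsKSCorrespondenceAlgebraicHK 2 hX) (θ : complexBetti X 2 →ₗ[ℂ] complexBetti X 2)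
    (h1 : ∀ y, IsRationalClass y → IsRationalClass (θ y))
    (h2 : ∀ (i j : ℕ) y, IsOfHodgeType 4 X 2 i j y → IsOfHodgeType 4 X 2 i j (θ y))
    (h4 : ∀ y : complexBetti X 2, ∀ d : complexBetti X 2, d ∈ algebraicClasses X 1 →
      k3HilbertForm 2 (φ (θ y)) (φ d) = 0)
    (h5 : ∀ y w : complexBetti X 2, k3HilbertForm 2 (φ (θ y)) (φ w) = k3HilbertForm 2 (φ y) (φ (θ w)))
    (d : ℚ) (hd : d ≠ 0)
    (hθθ : ∀ y : complexBetti X 2,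
      (∀ e : complexBetti X 2, e ∈ algebraicClasses X 1 → k3HilbertForm 2 (φ y) (φ e) = 0) →
      θ (θ y) = (d : ℂ) • y) :
    ∃ T : complexBetti X 2 →ₗ[ℂ] complexBetti X 2, IsAlgebraicCorrespondence 4 4 X X T ∧
      ∀ y : complexBetti X 2,
        (∀ e : complexBetti X 2, e ∈ algebraicClasses X 1 → k3HilbertForm 2 (φ y) (φ e) = 0) → T y = θ y := by
  classical
  have hX4 : IsSmoothProjective 4 X := hX
  haveI : Module.Finite ℚ (bettiCohomology X (2 * 1)) := BettiUniverse.finite hX (2 * 1)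
  obtain ⟨-, hint, -, ⟨h20, hspan⟩, -⟩ := id hM
  -- the period class and the positivity of the multiplier
  have htr0 := bbfTransc_of_twoZero hX hM h20
  have hdpos : 0 < d := multiplier_posHK hX hM θ h1 h2 h5 hd (hθθ _ htr0)
  have hσ0 : φ.symm z ≠ 0 := by
    obtain ⟨-, -, -, -, -, -, hzpos⟩ := id hM
    intro h0
    have hz : z = 0 := by rw [← φ.apply_symm_apply z, h0, map_zero]
    rw [hz, bbf_zero_right, Complex.zero_re] at hzpos
    exact lt_irrefl _ hzpos
  -- F1: the presentation `(T, −q_B|_T, ι)`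
  obtain ⟨b, T, Pol, hb, hbq, hirr, hK3T, htr, -, hj⟩ := exists_isTranscendentalPartHK hX hM
  haveI : Module.Finite ℚ T.toSubmodule :=
    Module.Finite.of_injective T.toSubmodule.subtype T.toSubmodule.injective_subtype
  have hT := mem_toSubmodule_iff_of_isTranscendentalPartHK hX hbq hj
  -- F2: `θ_T` and the second presentation `(T, −d·q_B|_T, ι ∘ θ_T)`
  obtain ⟨θT, hθT⟩ := exists_hom_transcendentalHK hX T hT θ h1 h2 h4
  have hgg : ∀ t, θT.toLinearMap (θT.toLinearMap t) = d • t := hom_transcendentalHK_sq hT hθT hθθ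
  have hga : ∀ a c : T.toSubmodule,
      b (ι[X] ((θT.toLinearMap a : T.toSubmodule) : bettiCohomology X (2 * 1))) (ι[X] (c : bettiCohomology X (2 * 1))) =
        b (ι[X] (a : bettiCohomology X (2 * 1))) (ι[X] ((θT.toLinearMap c : T.toSubmodule) : bettiCohomology X (2 * 1))) :=
    fun a c => by rw [hbq, hbq, bbf_hom_transcendentalHK hθT h5]
  have hjg : IsTranscendentalPartHK hX _ _ b T.toHodgeStructure (Pol.smul d hdpos) (T.subtypeHom.comp θT) :=
    isTranscendentalPartHK_smul_comp hX hj θT hdpos hgg hga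
  -- F2c: the two correspondences on ONE Kuga–Satake variety
  obtain ⟨A, μ, O₁, O₂, hμ, hO₁, hO₂, hO₁j, hO₂j⟩ :=
    exists_two_correspondences_of_kugaSatakeHK hX hKS hb hj hK3T θT hdpos hjg
  have hA : IsSmoothProjective A.dim A.X := AbelianVariety.isSmoothProjective_holds
  have hY : IsSmoothProjective (A.dim + A.dim) (A.X ⊗ A.X) := hA.tensor_holds hA
  have hn : 2 ≤ A.dim + A.dim := by
    have h := IsAlgebraicCorrespondence.le_two_mul hO₁
    omega
  have hO₁' : IsAlgebraicCorrespondence (A.dim + A.dim) 4 (A.X ⊗ A.X) X O₁ := hO₁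
  have hO₂' : IsAlgebraicCorrespondence (A.dim + A.dim) 4 (A.X ⊗ A.X) X O₂ := hO₂
  -- F3: the Lefschetz–transpose, back to `H²` through `B(X)`
  obtain ⟨R, hΦ₁, hΦ₂, hne⟩ := exists_lefschetzTransposeHK_of_charlesMarkman hCM hX4 hK hY hn hO₁' hO₂'
  -- `O₁` on `Θ(T_ℂ)`
  have hO₁x : ∀ x : ℂ ⊗[ℚ] T.toSubmodule, O₁ (Θ[X] (T.toSubmodule.subtype.baseChange ℂ x)) =
      ofRatClassBaseChange (Motives.ComplexPoints (A.X ⊗ A.X)) 2 (μ.baseChange ℂ x) := by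
    intro x
    induction x using TensorProduct.induction_on with
    | zero => simp only [map_zero]
    | tmul c t =>
      rw [LinearMap.baseChange_tmul, Submodule.subtype_apply, ofRatClassBaseChange_tmul, map_smul,
        LinearMap.baseChange_tmul, ofRatClassBaseChange_tmul]
      exact congrArg _ (hO₁j t)
    | add x y hx hy => simp only [map_add, hx, hy]
  -- `σ = Θ(sub x₀)`
  obtain ⟨x₀, hx₀⟩ := exists_baseChange_eq_of_bbfTransc hX hM T hT htr0
  have hx₀0 : x₀ ≠ 0 := by rintro rfl; exact hσ0 (by rw [← hx₀, map_zero, map_zero])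
  -- `O₁ σ ≠ 0` and `O₁ σ̄ = \overline{O₁ σ}`
  have hμC : Function.Injective (μ.baseChange ℂ) := by
    rw [LinearMap.baseChange_eq_ltensor]
    exact Module.Flat.lTensor_preserves_injective_linearMap _ hμ
  have hO₁σ0 : O₁ (φ.symm z) ≠ 0 := by
    rw [← hx₀, hO₁x]
    intro h0
    exact hx₀0 (hμC (ofRatClassBaseChange_injective _ _ (by rw [h0, map_zero, map_zero])))
  have hO₁conj : O₁ (conjClass _ (2 * 1) (φ.symm z)) = conjClass _ 2 (O₁ (φ.symm z)) := by
    rw [← hx₀, ← ofRatClassBaseChange_conj_eq₄ hX, conj_baseChange, hO₁x, hO₁x, ← conj_baseChange]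
    exact KaehlerRationalDatum.ofRatClassBaseChange_conj hY
      (BettiUniverse.realHodgeModel exists_isReal_hodgeModel_holds hY) _
  have hΦ₁σ : (R ∘ₗ O₁) (φ.symm z) ≠ 0 :=
    hne _ (isOfHodgeType_two_zero_of_isAlgebraicCorrespondenceHK hY hX4 hO₁' h20) hO₁σ0 hO₁conj
  -- `Φ₂ ∘ θ = Φ₁` on `T`
  have hrel : ∀ t : T.toSubmodule, (R ∘ₗ O₂) (θ (ι[X] (t : bettiCohomology X (2 * 1)))) =
      (R ∘ₗ O₁) (ι[X] (t : bettiCohomology X (2 * 1))) := by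
    intro t
    rw [LinearMap.comp_apply, LinearMap.comp_apply, ← hθT]
    exact congrArg R ((hO₂j t).trans (hO₁j t).symm)
  -- the cycle-induced Hodge endomorphisms of `T`
  let Rs : Submodule ℚ (Module.End ℚ T.toSubmodule) :=
    { carrier := {a | a ∈ T.toHodgeStructure.endAlg ∧
        ∃ f : complexBetti X 2 →ₗ[ℂ] complexBetti X 2, IsAlgebraicCorrespondence 4 4 X X f ∧
          ∀ t : T.toSubmodule, f (ι[X] (t : bettiCohomology X (2 * 1))) =
            ι[X] ((a t : T.toSubmodule) : bettiCohomology X (2 * 1))}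
      add_mem' := by
        rintro a a' ⟨haE, f, hf, hfa⟩ ⟨hbE, f', hf', hfb⟩
        refine ⟨add_mem haE hbE, f + f', IsAlgebraicCorrespondence.add hX4 hX4 hf hf', fun t => ?_⟩
        rw [LinearMap.add_apply, hfa, hfb, LinearMap.add_apply, Submodule.coe_add, map_add]
      zero_mem' := by
        refine ⟨zero_mem _, 0, isAlgebraicCorrespondence_zero hX4 hX4 (e := 4) rfl (by norm_num), fun t => ?_⟩
        rw [LinearMap.zero_apply, LinearMap.zero_apply, Submodule.coe_zero, map_zero]
      smul_mem' := by
        rintro c a ⟨haE, f, hf, hfa⟩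
        refine ⟨Subalgebra.smul_mem _ haE c, (c : ℂ) • f, IsAlgebraicCorrespondence.smul hX4 hX4 hf _, fun t => ?_⟩
        rw [LinearMap.smul_apply, hfa, LinearMap.smul_apply, Submodule.coe_smul, Motives.ofRatClass_smul] }
  have hRsE : ∀ a ∈ Rs, a ∈ T.toHodgeStructure.endAlg := fun a ha => ha.1
  have hRsmul : ∀ a ∈ Rs, ∀ a' ∈ Rs, a * a' ∈ Rs := by
    rintro a ⟨haE, f, hf, hfa⟩ a' ⟨hbE, f', hf', hfb⟩
    refine ⟨mul_mem haE hbE, f ∘ₗ f', IsAlgebraicCorrespondence.comp hX4 hX4 hX4 hf' hf (by norm_num), fun t => ?_⟩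
    rw [LinearMap.comp_apply, hfb, hfa, Module.End.mul_apply]
  have hgE : θT.toLinearMap ∈ T.toHodgeStructure.endAlg := θT.map_F_le
  -- `Θ` as an equivalence, and the retraction `(r ⊗ 1) ∘ Θ⁻¹`
  let Θe : (ℂ ⊗[ℚ] bettiCohomology X (2 * 1)) ≃ₗ[ℂ] complexBetti X (2 * 1) :=
    LinearEquiv.ofBijective (Θ[X]) ⟨ofRatClassBaseChange_injective _ _, ofRatClassBaseChange_surjective hX (2 * 1)⟩
  have hΘe : ∀ x, Θe x = Θ[X] x := fun _ => rfl
  have hΘe_symm : ∀ (c : ℂ) (w : bettiCohomology X (2 * 1)), Θe.symm (c • ι[X] w) = c ⊗ₜ[ℚ] w := by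
    intro c w
    apply Θe.injective
    rw [LinearEquiv.apply_symm_apply, hΘe, ofRatClassBaseChange_tmul]
  -- DESCENT: `(r ⊗ 1) Θ⁻¹ f ι` is a cycle-induced Hodge endomorphism of `T`, for every `ℂ`-algebraic `f`
  have hdesc : ∀ (r : ℂ →ₗ[ℚ] ℚ) {f : complexBetti X 2 →ₗ[ℂ] complexBetti X 2},
      IsAlgebraicCorrespondence 4 4 X X f → ∃ a ∈ Rs, ∀ t : T.toSubmodule,
        TensorProduct.lid ℚ _ (r.rTensor _ (Θe.symm (f (ι[X] (t : bettiCohomology X (2 * 1)))))) =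
          ((a t : T.toSubmodule) : bettiCohomology X (2 * 1)) := by
    intro r f hf
    obtain ⟨e, hab, γ, hγ, rfl⟩ := IsAlgebraicCorrespondence.exists_eq_corrAction hX4 hX4 hf
    suffices h : ∀ c : ℂ, ∃ a ∈ Rs, ∀ t : T.toSubmodule,
        TensorProduct.lid ℚ _ (r.rTensor _ (Θe.symm
          (c • corrAction complexOrientationFamily hX4 hX4 hab γ (ι[X] (t : bettiCohomology X (2 * 1)))))) =
          ((a t : T.toSubmodule) : bettiCohomology X (2 * 1)) by
      obtain ⟨a, ha, h1⟩ := h 1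
      exact ⟨a, ha, fun t => by rw [← h1 t, one_smul]⟩
    have hγ' := (le_of_eq (supportedClasses_eq_span_isRationalClass (hX4.tensor_holds hX4) (2 * e) e)) hγ
    clear hf hγ
    induction hγ' using Submodule.span_induction with
    | mem γ hγQ =>
      intro c
      obtain ⟨a, haE, ha⟩ := exists_endAlg_of_isRationalClassHK hX T htr hirr hK3T hab hγQ.2 hγQ.1
      have haR : a ∈ Rs :=
        ⟨haE, _, isAlgebraicCorrespondence_corrAction_complex hX4 hX4 hab (by norm_num) hγQ.2, ha⟩
      refine ⟨r c • a, Rs.smul_mem _ haR, fun t => ?_⟩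
      rw [ha t, hΘe_symm, lid_rTensor_tmul, LinearMap.smul_apply, Submodule.coe_smul]
    | zero =>
      intro c
      refine ⟨0, Rs.zero_mem, fun t => ?_⟩
      rw [map_zero, LinearMap.zero_apply, smul_zero, map_zero, map_zero, map_zero, LinearMap.zero_apply,
        Submodule.coe_zero]
    | add γ γ' _ _ h h' =>
      intro c
      obtain ⟨a, ha, hat⟩ := h c
      obtain ⟨a', ha', hat'⟩ := h' c
      refine ⟨a + a', Rs.add_mem ha ha', fun t => ?_⟩
      rw [map_add, LinearMap.add_apply, smul_add, map_add, map_add, map_add, hat, hat', LinearMap.add_apply,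
        Submodule.coe_add]
    | smul c' γ _ h =>
      intro c
      obtain ⟨a, ha, hat⟩ := h (c * c')
      refine ⟨a, ha, fun t => ?_⟩
      rw [(corrAction complexOrientationFamily hX4 hX4 hab).map_smul, LinearMap.smul_apply, smul_smul]
      exact hat t
  -- a rational vector of `T` where `Φ₁` does not vanish
  have hzero_or : ∃ t₀ : T.toSubmodule, (R ∘ₗ O₁) (ι[X] (t₀ : bettiCohomology X (2 * 1))) ≠ 0 := by
    by_contra hall
    push Not at hall
    have hzero : ∀ x : ℂ ⊗[ℚ] T.toSubmodule, (R ∘ₗ O₁) (Θ[X] (T.toSubmodule.subtype.baseChange ℂ x)) = 0 := by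
      intro x
      induction x using TensorProduct.induction_on with
      | zero => rw [map_zero, map_zero, map_zero]
      | tmul c t =>
        rw [LinearMap.baseChange_tmul, Submodule.subtype_apply, ofRatClassBaseChange_tmul, map_smul, hall t,
          smul_zero]
      | add x y hx hy => rw [map_add, map_add, map_add, hx, hy, add_zero]
    apply hΦ₁σ
    rw [← hx₀]
    exact hzero x₀
  obtain ⟨t₀, ht₀⟩ := hzero_or
  have hξ : Θe.symm ((R ∘ₗ O₁) (ι[X] (t₀ : bettiCohomology X (2 * 1)))) ≠ 0 := by
    intro h0
    apply ht₀
    have h := congrArg Θe h0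
    rwa [LinearEquiv.apply_symm_apply, map_zero] at h
  obtain ⟨r, hr⟩ := exists_rat_retraction_ne_zero hξ
  -- the descended endomorphisms `a₁, a₂ ∈ Rs` with `a₂ θ_T = a₁ ≠ 0`
  obtain ⟨a₁, ha₁R, ha₁⟩ := hdesc r hΦ₁
  obtain ⟨a₂, ha₂R, ha₂⟩ := hdesc r hΦ₂
  have ha₁0 : a₁ ≠ 0 := by
    intro h0
    apply hr
    rw [ha₁ t₀, h0, LinearMap.zero_apply, Submodule.coe_zero]
  have hmulrel : a₂ * θT.toLinearMap = a₁ := by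
    refine LinearMap.ext fun t => Subtype.ext ?_
    rw [Module.End.mul_apply, ← ha₂, ← ha₁, hθT, hrel t]
  -- Zarhin: `End_Hdg(T)` is a field; the subfield trick
  obtain ⟨hField, -⟩ := Zarhin1983_endAlg_isField_holds T.toHodgeStructure hirr hK3T
  have hgR : θT.toLinearMap ∈ Rs :=
    mem_of_mul_eq_of_isField hField Rs hRsE hRsmul ha₁R ha₂R hgE ha₁0 hmulrel
  obtain ⟨-, f, hf, hfθ⟩ := hgR
  refine ⟨f, hf, fun y hy => ?_⟩
  obtain ⟨x, rfl⟩ := exists_baseChange_eq_of_bbfTransc hX hM T hT hy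
  clear hy
  induction x using TensorProduct.induction_on with
  | zero => rw [map_zero, map_zero, map_zero, map_zero]
  | tmul c t =>
    rw [LinearMap.baseChange_tmul, Submodule.subtype_apply, ofRatClassBaseChange_tmul, map_smul, map_smul,
      hfθ t, hθT t]
  | add x y hx hy => rw [map_add, map_add, map_add, map_add, hx, hy]

end Summit.HodgeConjecture.HodgeConjecture.Theorems.MarkmanPartnerTransport.KugaSatakeHK

end
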